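import Mathlib
import Summits.Ventures.HodgeRepro2.T6A1WeilDescent
import Summits.Ventures.HodgeRepro2.T6A1WeilLine

/-!
# T6A1ProjData — the Weil projector as explicit data `(x, Q)` (Prop. A2.3, packaged)

Tier-6 sub-goal A1 (route/T6-A1-t6-p1.md §1 (A1.iii); §3 layer L2). `T6A1WeilDescent.exists_weilProjector`
is existential; the complex side of A1 (Lemma A1.3 over `ℂ`, Theorem A(i)'s bridge) needs the SAME
`(x, Q)` on both sides of the base change, together with the two facts the existential hides: `x` is
separating (Lemma A2.1) and `Q` is the rational form of the Lagrange polynomial (Lemma A2.2). This file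
packages them as `WeilProjData` and re-derives every property of `p_W := Q([x]^*)` from the exported
lemmas of `T6A1WeilDescent` / `T6A1WeilLine`: idempotent, range = the descended Weil line (`W₀ ⊗ F =
⊕_σ ⋀^n V_σ`), `ℚ`-dimension `[F : ℚ]`, stability clause, and `range p_W = weilLine 4 V` (p1's form,
the interface's `weilQ`).
-/

namespace Summit.Ventures.HodgeRepro2.T6.A1ProjData

open Polynomial A1WeilProjector A1WeilDescent A1WeilLine
open scoped TensorProduct

section generic

variable (F : Type*) [Field F] [Algebra ℚ F] [FiniteDimensional ℚ F] [IsGalois ℚ F]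
variable [DecidableEq (F →ₐ[ℚ] F)] [DecidableEq F]

/-- The data of the Weil projector in degree `n`: a separating element `x ∈ F` (Lemma A2.1) and the
rational form `Q ∈ ℚ[X]` of its Lagrange projector polynomial (Lemma A2.2). -/
structure WeilProjData (n : ℕ) where
  /-- the separating element -/
  x : F
  /-- the rational projector polynomial -/
  Q : ℚ[X]
  /-- the eigenvalues `χ_k(x)` are pairwise distinct -/
  sep : Function.Injective (chi F n x)
  /-- `Q` is the Lagrange projector polynomial over `F` -/
  map_eq : Q.map (algebraMap ℚ F) = lagrangeP F n x

/-- Lemmas A2.1–A2.2: the data exist. -/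
theorem exists_weilProjData (n : ℕ) : Nonempty (WeilProjData F n) := by
  obtain ⟨x, hx⟩ := exists_separating_chi F n
  obtain ⟨Q, hQ⟩ := exists_rat_lagrangeP F n x
  exact ⟨⟨x, Q, hx, hQ⟩⟩

namespace WeilProjData

variable {F} {n : ℕ} (P : WeilProjData F n)
variable (V : Type*) [AddCommGroup V] [Module ℚ V] [Module F V] [IsScalarTower ℚ F V]
  [FiniteDimensional F V]

/-- The Weil projector `p_W := Q([x]^*)` on `⋀[ℚ]^n V`. -/
noncomputable def proj : Module.End ℚ (⋀[ℚ]^n V) := aeval (T F V n P.x) P.Q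

omit [IsGalois ℚ F] [FiniteDimensional F V] in
/-- Over `F`, `Q` becomes the projector `e_F`. -/
theorem aeval_TF_map : aeval (TF F V n P.x) (P.Q.map (algebraMap ℚ F)) = eF F V n P.x := by
  rw [P.map_eq]
  rfl

variable {I : Type*} [LinearOrder I] (b : Module.Basis I ℚ V)

omit [IsGalois ℚ F] [FiniteDimensional F V] in
/-- Through p7's `baseChangeEquiv`, the base change of `p_W` is `e_F`. -/
theorem baseChangeEquiv_proj (v : F ⊗[ℚ] ⋀[ℚ]^n V) :
    A1ExteriorBaseChange.baseChangeEquiv ℚ F V n b (LinearMap.baseChange F (P.proj V) v) =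
      eF F V n P.x (A1ExteriorBaseChange.baseChangeEquiv ℚ F V n b v) := by
  rw [proj, baseChangeEquiv_aeval, aeval_TF_map]

/-- `p_W` is idempotent (Prop. A2.3(i)). -/
theorem isIdempotentElem_proj : IsIdempotentElem (P.proj V) := by
  classical
  haveI : FiniteDimensional ℚ V := Module.Finite.trans F V
  let b := Module.finBasis ℚ V
  apply A1BaseChange.baseChange_inj (K := F)
  rw [LinearMap.baseChange_mul]
  apply LinearMap.ext
  intro v
  apply (A1ExteriorBaseChange.baseChangeEquiv ℚ F V n b).injective
  rw [Module.End.mul_apply, P.baseChangeEquiv_proj V b, P.baseChangeEquiv_proj V b, eF_eF F V n P.x P.sep]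

omit [FiniteDimensional F V] in
/-- The range of `p_W` base-changes to the Weil summand `⊕_σ ⋀^n V_σ` (Prop. A2.3(iv)). -/
theorem baseChange_range_proj :
    Submodule.baseChange F (LinearMap.range (P.proj V)) =
      A1SplitSummandDescent.eigenSummandK ℚ F F V n b := by
  rw [← A1BaseChange.range_baseChange, A1SplitSummandDescent.eigenSummandK]
  ext v
  rw [Submodule.mem_comap, LinearMap.mem_range]
  constructor
  · rintro ⟨w, rfl⟩
    rw [LinearEquiv.coe_coe, P.baseChangeEquiv_proj V b]
    exact eF_apply_mem F V n P.x P.sep _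
  · intro hv
    refine ⟨v, ?_⟩
    apply (A1ExteriorBaseChange.baseChangeEquiv ℚ F V n b).injective
    rw [P.baseChangeEquiv_proj V b]
    exact eF_apply_of_mem_eigenSummand F V n P.x P.sep hv

omit [IsGalois ℚ F] [FiniteDimensional F V] in
/-- `p_W` maps every `[x]^*`-stable subspace `A` into `A ⊓ W` (Prop. A2.3(ii): algebraic classes). -/
theorem proj_mem_inf_of_stable (A : Submodule ℚ (⋀[ℚ]^n V)) (hA : ∀ v ∈ A, T F V n P.x v ∈ A)
    {v : ⋀[ℚ]^n V} (hv : v ∈ A) : P.proj V v ∈ A ⊓ LinearMap.range (P.proj V) :=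
  ⟨BridgeProjector.aeval_apply_mem_of_stable A hA P.Q hv, ⟨v, rfl⟩⟩

/-- `p_W` is the identity on its range. -/
theorem proj_apply_of_mem_range {w : ⋀[ℚ]^n V} (hw : w ∈ LinearMap.range (P.proj V)) :
    P.proj V w = w := by
  obtain ⟨v, rfl⟩ := hw
  exact congrArg (fun g => g v) (P.isIdempotentElem_proj V)

omit [IsGalois ℚ F] [FiniteDimensional F V] in
/-- The range of `p_W` is stable under every `[a]^*`. -/
theorem T_mem_range_proj (a : F) {w : ⋀[ℚ]^n V} (hw : w ∈ LinearMap.range (P.proj V)) :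
    T F V n a w ∈ LinearMap.range (P.proj V) :=
  T_mem_range_aeval F V n a P.x P.Q hw

omit b in
/-- Prop. A2.3(iv), the dimension: `dim_ℚ W = [F : ℚ]` when `n = rank_F V`. -/
theorem finrank_range_proj (hn : Module.finrank F V = n) [NeZero n] :
    Module.finrank ℚ (LinearMap.range (P.proj V)) = Module.finrank ℚ F := by
  classical
  haveI : FiniteDimensional ℚ V := Module.Finite.trans F V
  let b := Module.finBasis ℚ V
  haveI : NeZero (Module.finrank F V) := ⟨by rw [hn]; exact NeZero.ne n⟩
  have key : ∀ (m : ℕ) (hm : Module.finrank F V = m) (W : Submodule ℚ (⋀[ℚ]^m V)),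
      Submodule.baseChange F W = A1SplitSummandDescent.eigenSummandK ℚ F F V m b →
        Module.finrank ℚ W = Module.finrank ℚ F := by
    intro m hm W hW'
    subst hm
    exact A1DescendedBijection.finrank_descended_top ℚ F V b W hW'
  exact key n hn _ (P.baseChange_range_proj V b)

end WeilProjData

end generic

section numberField

variable {F : Type*} [Field F] [NumberField F] [IsGalois ℚ F]
variable [DecidableEq (F →ₐ[ℚ] F)] [DecidableEq F]
variable (V : Type*) [AddCommGroup V] [Module ℚ V] [Module F V] [IsScalarTower ℚ F V]
  [FiniteDimensional F V]

/-- p1's `weilLine 4 V` (the interface's `weilQ`) is the range of `p_W` (Lemma A1.3 / Prop. A2.3(iv)). -/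
theorem WeilProjData.weilLine_eq_range_proj (P : WeilProjData F 4) (hn : Module.finrank F V = 4) :
    weilLine (K := F) 4 V = LinearMap.range (P.proj V) := by
  classical
  haveI : FiniteDimensional ℚ V := Module.Finite.trans F V
  let b := Module.finBasis ℚ V
  exact weilLine_eq_range F V b hn P.x P.Q (P.isIdempotentElem_proj V) (P.baseChange_range_proj V b)

end numberField

end Summit.Ventures.HodgeRepro2.T6.A1ProjData
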